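import Summits.AtomisticToContinuum.HydrodynamicLimit.Theorems.RelayRaceLocalityNearConstantShortTimeHLOrbitExpansion
import HarnessLib

/-!
# Crux `NearConstantShortTimeHL` (stmt-AtomisticToContinuum-12502), line `small-tilt-domination`:
# the expectation-level window estimate (stub `window_estimate`)

Support file for the crux `…Theses.RelayRaceLocality.NearConstantShortTimeHL`, line `small-tilt-domination`
(route: Yau's relative-entropy method, Grönwall assembly `stub_gronwallAssembly`; lead c4, wave 2b),
registered stub **`window_estimate`** (3a-ii).

For a hard-sphere flow `Φ` on `𝕋³` and a probability law `P ≪ Liouville` on the `n`-particle phase space, the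
entropy deficit `D(r) = mst(r) − E_P[X_r ∘ Φ_r]` grows over a window `[s, s + τ]` by at most the priced
fluctuation and tail integrals, the closure defects `2d`, the commutator term `C₃ (1 + E_P K)` and the bad-event
terms `2 CX · E_P[(1 + K) ; G'ᶜ] + CE · P(G'ᶜ)`.  All pathwise inputs (the expansion on the good event `G'`, the
crude bounds `|X| ≤ CX (1 + K)`, `|mst(s + τ) − mst(s)| ≤ CE`) are hypotheses; the proof is measure theory:

* good points are `P`-almost all points (`HardSphereFlow.ae_mem_good`, transferred along `P ≪ Liouville`), and
  the kinetic energy per particle `K` is conserved along good orbits (`wc_kineticPP_flow`);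
* hence `P`-a.e. the increment `A = X_{s+τ} ∘ Φ_{s+τ} − X_s ∘ Φ_s` is bounded below by the integrable function
  `L = 𝟙_{G'} Δ − (2d + C₁ IF + C₂ IT + C₃ (1 + K)) − 2 CX 𝟙_{G'ᶜ} (1 + K)` (`Δ = mst(s + τ) − mst(s)`;
  `IF, IT ≥ 0` the window integrals of the nonnegative prices): on `G'` by the expansion, off `G'` by the
  crude bounds;
* integrate (`integral_mono_ae`), evaluate `E_P L` (`integral_indicator_const`, `integral_indicator`), and use
  `P(G') + P(G'ᶜ) = 1` and `Δ · P(G'ᶜ) ≤ CE · P(G'ᶜ)`.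

No definitions, no named facts.  References: H.-T. Yau, Lett. Math. Phys. 22 (1991) §2.
-/

noncomputable section

namespace Summit.AtomisticToContinuum.HydrodynamicLimit.Theorems.NearConstantShortTimeHL

open scoped BigOperators ENNReal Topology
open MeasureTheory Set Filter
open Literature.MathematicalPhysics.KineticTheory Literature.Analysis.FluidPDE Literature.Analysis.FunctionSpaces

/-- **Pointwise lower bound from an absolute expansion.** If `|A − Δ − dM − dE| ≤ B` with `|dM| ≤ d` and
`|dE| ≤ d`, then `Δ − 2d − B ≤ A`. [folklore] -/
theorem xo_lower_of_abs_expansion {A Δ dM dE d B : ℝ} (h : |A - Δ - dM - dE| ≤ B) (hM : |dM| ≤ d)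
    (hE : |dE| ≤ d) : Δ - 2 * d - B ≤ A := by
  have h1 := (abs_le.1 h).1
  have h2 := (abs_le.1 hM).1
  have h3 := (abs_le.1 hE).1
  linarith

/-- **Pointwise lower bound from a crude bound.** If `|a| ≤ c (1 + k)` and `|b| ≤ c (1 + k)`, then
`−(2 c (1 + k)) ≤ a − b`. [folklore] -/
theorem xo_lower_of_crude {a b c k : ℝ} (ha : |a| ≤ c * (1 + k)) (hb : |b| ≤ c * (1 + k)) :
    -(2 * c * (1 + k)) ≤ a - b := by
  have h1 := (abs_le.1 ha).1
  have h2 := (abs_le.1 hb).2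
  linarith

/-- The kinetic energy per particle `K(w) = n⁻¹ Σᵢ ‖vᵢ‖² / 2` is nonnegative. [folklore] -/
theorem xo_kineticPP_nonneg {n : ℕ} (w : Config n (Fin 3) T3) : 0 ≤ kineticPP w := by
  unfold kineticPP; positivity

/-- **Registered stub `window_estimate` (3a-ii): the expectation-level window estimate of the relative-entropy
Grönwall.**  For a hard-sphere flow `Φ` on `𝕋³`, a probability law `P ≪ Liouville`, a window `[s, s + τ]`, an
observable `X`, a macroscopic entropy `mst`, nonnegative prices `Fl, Tl`, defects `dM, dE` and a measurable good
event `G'`: if on `G' ∩ good` the pathwise expansion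
`|X_{s+τ}(Φ_{s+τ} z) − X_s(Φ_s z) − (mst(s+τ) − mst(s)) − dM z − dE z| ≤ C₁ ∫ Fl + C₂ ∫ Tl + C₃ (1 + K z)` holds with
`|dM|, |dE| ≤ d`, and everywhere `|X_{s+τ}|, |X_s| ≤ CX (1 + K)`, `|mst(s+τ) − mst(s)| ≤ CE`, then (under the stated
integrability hypotheses) the deficit `D(r) = mst(r) − E_P[X_r ∘ Φ_r]` satisfies
`D(s+τ) − D(s) ≤ C₁ E_P ∫ Fl + C₂ E_P ∫ Tl + 2d + C₃ (1 + E_P K) + 2 CX E_P[(1 + K); G'ᶜ] + CE · P(G'ᶜ)`.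
Proof: `P`-a.e. point is good (`P ≪ Liouville`, `HardSphereFlow.ae_mem_good`) and `K ∘ Φ_r = K` there
(`wc_kineticPP_flow`), so the increment is a.e. bounded below by
`𝟙_{G'} Δ − (2d + C₁ IF + C₂ IT + C₃ (1 + K)) − 2 CX 𝟙_{G'ᶜ} (1 + K)`; integrate and use `P(G') + P(G'ᶜ) = 1`.
[cite: Yau1991, §2] -/
theorem window_estimate : ∀ {ε : ℝ} {n : ℕ} (Φ : HardSphereFlow (Torus.geometry (Fin 3)) ε n) (P : Measure (Config n (Fin 3) T3)) [IsProbabilityMeasure P], P ≪ liouville (Torus.geometry (Fin 3)) n ε → ∀ {s τ : ℝ}, 0 < τ → ∀ (X : ℝ → Config n (Fin 3) T3 → ℝ) (mst : ℝ → ℝ) (Fl Tl : ℝ → Config n (Fin 3) T3 → ℝ) (dM dE : Config n (Fin 3) T3 → ℝ) (G' : Set (Config n (Fin 3) T3)), MeasurableSet G' → ∀ {C₁ C₂ C₃ CX CE d : ℝ}, 0 ≤ C₁ → 0 ≤ C₂ → 0 ≤ C₃ → 0 ≤ CX → 0 ≤ d → (∀ z ∈ G', z ∈ Φ.good → |X (s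 + τ) (Φ.flow (s + τ) z) - X s (Φ.flow s z) - (mst (s + τ) - mst s) - dM z - dE z| ≤ C₁ * (∫ r in s..(s + τ), Fl r (Φ.flow r z)) + C₂ * (∫ r in s..(s + τ), Tl r (Φ.flow r z)) + C₃ * (1 + kineticPP z) ∧ |dM z| ≤ d ∧ |dE z| ≤ d) → (∀ w : Config n (Fin 3) T3, |X (s + τ) w| ≤ CX * (1 + kineticPP w)) → (∀ w : Config n (Fin 3) T3, |X s w| ≤ CX * (1 + kineticPP w)) → |mst (s + τ) - mst s| ≤ CE → (∀ r, ∀ w : Config n (Fin 3) T3, 0 ≤ Fl r w) → (∀ r, ∀ w : Config n (Fin 3) T3, 0 ≤ Tl r w) → Integrable (fun z => X (s + τ) (Φ.flow (s + τ) z)) P → Integrable (fun z => X s (Φ.flow s z)) P → Integrable (fun z => kineticPP z) P → Integrable (fun z => ∫ r in s..(s + τ), Fl r (Φ.flow r z)) P → Integrable (fun z => ∫ r in s..(s + τ), Tl r (Φ.flow r z)) P → (∀ z ∈ Φ.good, 0 ≤ ∫ r in s..(s + τ), Fl r (Φ.flow r z)) → (∀ z ∈ Φ.good, 0 ≤ ∫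 r in s..(s + τ), Tl r (Φ.flow r z)) → (mst (s + τ) - ∫ z, X (s + τ) (Φ.flow (s + τ) z) ∂P) - (mst s - ∫ z, X s (Φ.flow s z) ∂P) ≤ C₁ * (∫ z, (∫ r in s..(s + τ), Fl r (Φ.flow r z)) ∂P) + C₂ * (∫ z, (∫ r in s..(s + τ), Tl r (Φ.flow r z)) ∂P) + 2 * d + C₃ * (1 + ∫ z, kineticPP z ∂P) + 2 * CX * (∫ z in G'ᶜ, (1 + kineticPP z) ∂P) + CE * (P G'ᶜ).toReal := by
  intro ε n Φ P _ hP s τ _hτ X mst Fl Tl dM dE G' hG' C₁ C₂ C₃ CX CE d hC₁ hC₂ hC₃ hCX hd hpath hX₁ hX₀ hCE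
    _hFl _hTl hiX₁ hiX₀ hiK hiF hiT hF0 hT0
  -- good points are `P`-almost all points
  have hgood : ∀ᵐ z ∂P, z ∈ Φ.good := hP.ae_le Φ.ae_mem_good
  -- the a.e. lower bound of the increment by the integrable function `L`
  have hlow : ∀ᵐ z ∂P, G'.indicator (fun _ => mst (s + τ) - mst s) z -
      (2 * d + C₁ * (∫ r in s..(s + τ), Fl r (Φ.flow r z)) + C₂ * (∫ r in s..(s + τ), Tl r (Φ.flow r z)) +
        C₃ * (1 + kineticPP z)) -
      2 * CX * G'ᶜ.indicator (fun w => 1 + kineticPP w) z ≤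
      X (s + τ) (Φ.flow (s + τ) z) - X s (Φ.flow s z) := by
    filter_upwards [hgood] with z hz
    have hKz : 0 ≤ kineticPP z := xo_kineticPP_nonneg z
    by_cases hzG : z ∈ G'
    · obtain ⟨h1, h2, h3⟩ := hpath z hzG hz
      have h := xo_lower_of_abs_expansion h1 h2 h3
      rw [indicator_of_mem hzG, indicator_of_notMem (fun h' : z ∈ G'ᶜ => h' hzG), mul_zero, sub_zero]
      linarith
    · have h1 := hX₁ (Φ.flow (s + τ) z)
      have h0 := hX₀ (Φ.flow s z)
      rw [wc_kineticPP_flow Φ hz] at h1 h0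
      have h := xo_lower_of_crude h1 h0
      rw [indicator_of_notMem hzG, indicator_of_mem (mem_compl hzG), zero_sub]
      have hF := mul_nonneg hC₁ (hF0 z hz)
      have hT := mul_nonneg hC₂ (hT0 z hz)
      have hK := mul_nonneg hC₃ (by linarith : (0 : ℝ) ≤ 1 + kineticPP z)
      linarith
  -- integrability bookkeeping
  have hi1 : Integrable (fun z => G'.indicator (fun _ => mst (s + τ) - mst s) z) P :=
    (integrable_const _).indicator hG'
  have hiK1 : Integrable (fun z => 1 + kineticPP z) P := (integrable_const 1).add hiK
  have hi2b : Integrable (fun z => 2 * d + C₁ * (∫ r in s..(s + τ), Fl r (Φ.flow r z))) P :=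
    (integrable_const _).add (hiF.const_mul C₁)
  have hi2a : Integrable (fun z => 2 * d + C₁ * (∫ r in s..(s + τ), Fl r (Φ.flow r z)) +
      C₂ * (∫ r in s..(s + τ), Tl r (Φ.flow r z))) P :=
    hi2b.add (hiT.const_mul C₂)
  have hi2 : Integrable (fun z => 2 * d + C₁ * (∫ r in s..(s + τ), Fl r (Φ.flow r z)) +
      C₂ * (∫ r in s..(s + τ), Tl r (Φ.flow r z)) + C₃ * (1 + kineticPP z)) P :=
    hi2a.add (hiK1.const_mul C₃)
  have hi3 : Integrable (fun z => 2 * CX * G'ᶜ.indicator (fun w => 1 + kineticPP w) z) P :=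
    (hiK1.indicator hG'.compl).const_mul (2 * CX)
  -- evaluation of `E_P L`
  have hI1 : ∫ z, G'.indicator (fun _ => mst (s + τ) - mst s) z ∂P = P.real G' * (mst (s + τ) - mst s) := by
    rw [integral_indicator_const _ hG', smul_eq_mul]
  have hId : ∫ _z, 2 * d ∂P = 2 * d := by
    rw [integral_const, smul_eq_mul, probReal_univ, one_mul]
  have hIF : ∫ z, C₁ * (∫ r in s..(s + τ), Fl r (Φ.flow r z)) ∂P =
      C₁ * ∫ z, (∫ r in s..(s + τ), Fl r (Φ.flow r z)) ∂P :=
    integral_const_mul _ _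
  have hIT : ∫ z, C₂ * (∫ r in s..(s + τ), Tl r (Φ.flow r z)) ∂P =
      C₂ * ∫ z, (∫ r in s..(s + τ), Tl r (Φ.flow r z)) ∂P :=
    integral_const_mul _ _
  have hIK : ∫ z, C₃ * (1 + kineticPP z) ∂P = C₃ * (1 + ∫ z, kineticPP z ∂P) := by
    rw [integral_const_mul, integral_add (integrable_const _) hiK, integral_const, smul_eq_mul, probReal_univ,
      one_mul]
  have hI2 : ∫ z, (2 * d + C₁ * (∫ r in s..(s + τ), Fl r (Φ.flow r z)) +
      C₂ * (∫ r in s..(s + τ), Tl r (Φ.flow r z)) + C₃ * (1 + kineticPP z)) ∂P =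
      2 * d + C₁ * (∫ z, (∫ r in s..(s + τ), Fl r (Φ.flow r z)) ∂P) +
        C₂ * (∫ z, (∫ r in s..(s + τ), Tl r (Φ.flow r z)) ∂P) + C₃ * (1 + ∫ z, kineticPP z ∂P) := by
    rw [integral_add hi2a (hiK1.const_mul C₃), integral_add hi2b (hiT.const_mul C₂),
      integral_add (integrable_const _) (hiF.const_mul C₁), hId, hIF, hIT, hIK]
  have hI3 : ∫ z, 2 * CX * G'ᶜ.indicator (fun w => 1 + kineticPP w) z ∂P =
      2 * CX * ∫ z in G'ᶜ, (1 + kineticPP z) ∂P := by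
    rw [integral_const_mul, integral_indicator hG'.compl]
  -- integrate the a.e. lower bound
  have hi12 : Integrable (fun z => G'.indicator (fun _ => mst (s + τ) - mst s) z -
      (2 * d + C₁ * (∫ r in s..(s + τ), Fl r (Φ.flow r z)) + C₂ * (∫ r in s..(s + τ), Tl r (Φ.flow r z)) +
        C₃ * (1 + kineticPP z))) P :=
    hi1.sub hi2
  have hiL : Integrable (fun z => G'.indicator (fun _ => mst (s + τ) - mst s) z -
      (2 * d + C₁ * (∫ r in s..(s + τ), Fl r (Φ.flow r z)) + C₂ * (∫ r in s..(s + τ), Tl r (Φ.flow r z)) +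
        C₃ * (1 + kineticPP z)) -
      2 * CX * G'ᶜ.indicator (fun w => 1 + kineticPP w) z) P :=
    hi12.sub hi3
  have hiA : Integrable (fun z => X (s + τ) (Φ.flow (s + τ) z) - X s (Φ.flow s z)) P := hiX₁.sub hiX₀
  have hmono := integral_mono_ae hiL hiA hlow
  rw [integral_sub hi12 hi3, integral_sub hi1 hi2, integral_sub hiX₁ hiX₀, hI1, hI2, hI3] at hmono
  -- `P(G') + P(G'ᶜ) = 1` and the sign-blind bound on `Δ · P(G'ᶜ)`
  have hprob : P.real G' + (P G'ᶜ).toReal = 1 := probReal_add_probReal_compl hG'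
  have hprob' : P.real G' = 1 - (P G'ᶜ).toReal := by linarith
  have hΔ : (P G'ᶜ).toReal * (mst (s + τ) - mst s) ≤ CE * (P G'ᶜ).toReal := by
    rw [mul_comm]
    exact mul_le_mul_of_nonneg_right ((le_abs_self _).trans hCE) ENNReal.toReal_nonneg
  rw [hprob'] at hmono
  linarith

end Summit.AtomisticToContinuum.HydrodynamicLimit.Theorems.NearConstantShortTimeHL

end
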